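import Mathlib
import Summits.Ventures.PercRepro2.Defs
import Summits.Ventures.PercRepro2.Harris
import Summits.Ventures.PercRepro2.Graph
import Summits.Ventures.PercRepro2.Events
import Summits.Ventures.PercRepro2.Induced

/-!
# The candidate (CR) is FALSE: a kernel-checked counterexample (blind cell PercRepro2, mine-a g40;
MINE-A.md §95.4)

The candidate (CR) of MINE-A.md §93.9–§93.11 (the hypothesis `hcr` of
`CRForms.xorForm_nonneg_of_cr`): for a root `s`, a finite set `X`, `R = {s ↮ X}` and up-sets
`U = {C_s ∈ 𝓤}`, `e = {C_s ∈ 𝓥}` of the cluster of `s`,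

  `0 ≤ P(R)·P(Rᶜ ∩ U ∩ e) + P(R ∩ U)·P(R ∩ e) − P(R)·P(U)·P(e)`   (⟺ `Cov(U, e) ≥ P(R)·Cov(U, e ∣ R)`).

THE WITNESS `Θ₅`: vertices `0..4`, root `0`, six edges `0–2 (7/8)`, `0–1 (3/4)`, `1–2 (1/2)`,
`0–3 (3/4)`, `2–3 (1/2)`, `2–4 (1/8)` (a hub `2` almost surely joined to the root, two alternative
routes `0–1–2`, `0–3–2`, and a pendant `4` on the hub), `X = {4}`, `𝓤 = {S ∣ 1 ∈ S}`,
`𝓥 = {S ∣ 3 ∈ S}`.  In units of `8⁻⁶ = 1/262144`: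

  `P(R) = 230976`, `P(U) = P(e) = 226816`, `P(R ∩ U) = P(R ∩ e) = 199424`, `P(Rᶜ ∩ U ∩ e) = 24064`,

so the (CR) form equals `−10481 / 2³⁰ ≈ −9.76·10⁻⁶ < 0`.  The six masses are established by
`decide` (kernel evaluation of the `2⁶` configurations with the cell's own `prob`, `weight`,
`avoidAll`, `clusterInEvent`, `Conn` — reachability decided by Mathlib's
`SimpleGraph.instDecidableRelReachable`), the weights are rescaled to the integers `wt ω` (`weight_eq`),
and the inequality follows by `norm_num`.  Mechanism (MINE-A.md §95.4): `U = {1 ∈ C_0}` and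
`e = {3 ∈ C_0}` are negatively correlated given `4 ∈ C_0` (when the hub edge `0–2` is closed the hub
is reached through `1` or through `3`), while the polarisation `P(R)·ΔU·Δe` that (CR) offers in
compensation is too small because the avoidance of the pendant `4` barely changes `P(U)`.
Consequently `(CR)` holds on forests and triangular cacti (kernel, `CRForest`, `CRCactus`) but not in
general; the weaker `(XOR)` of `XorHalf` is not refuted by this instance (its value here is
`+4.1·10⁻¹⁰`).  Four definitions (`ends`, `p`, `num`, `wt`), decidability instances for this
instance only, no notation; one seat.
-/

namespace Summit.Ventures.PercRepro2

namespace CRCounterexample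

/-- The six edges of the witness `Θ₅`: `0–2, 0–1, 1–2, 0–3, 2–3, 2–4`. -/
def ends : Fin 6 → Sym2 (Fin 5) := ![s(0, 2), s(0, 1), s(1, 2), s(0, 3), s(2, 3), s(2, 4)]

/-- The edge weights `7/8, 3/4, 1/2, 3/4, 1/2, 1/8`. -/
def p : Fin 6 → ℚ := ![7/8, 3/4, 1/2, 3/4, 1/2, 1/8]

/-- The numerators of the weights in eighths: `7, 6, 4, 6, 4, 1`. -/
def num : Fin 6 → ℕ := ![7, 6, 4, 6, 4, 1]

/-- The integer weight of a configuration: `8⁶ · weight p ω`. -/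
def wt (ω : Config (Fin 6)) : ℕ := ∏ e, (if ω e then num e else 8 - num e)

/-- The weights are admissible. -/
lemma p_isProbVec : IsProbVec p := by
  refine ⟨fun e => ?_, fun e => ?_⟩ <;> fin_cases e <;> norm_num [p]

/-- One Bernoulli factor in eighths. -/
lemma edgeFactor_eq (e : Fin 6) (b : Bool) :
    edgeFactor (p e) b = ((if b then num e else 8 - num e : ℕ) : ℚ) / 8 := by
  fin_cases e <;> cases b <;> norm_num [p, num, edgeFactor]

/-- `weight p ω = wt ω / 8⁶`. -/
lemma weight_eq (ω : Config (Fin 6)) : weight p ω = (wt ω : ℚ) / 8 ^ 6 := by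
  unfold weight wt
  simp only [edgeFactor_eq]
  rw [Finset.prod_div_distrib, Nat.cast_prod]
  simp

/-- Open adjacency is decidable on this instance. -/
instance instDecOpenAdj (ω : Config (Fin 6)) (u v : Fin 5) : Decidable (OpenAdj ends ω u v) :=
  inferInstanceAs (Decidable (∃ e, ω e = true ∧ ends e = s(u, v)))

/-- Adjacency of the open subgraph is decidable. -/
instance instDecAdj (ω : Config (Fin 6)) : DecidableRel (openGraph ends ω).Adj := fun u v =>
  decidable_of_iff (u ≠ v ∧ OpenAdj ends ω u v) openGraph_adj.symm

/-- Connection is decidable (Mathlib: reachability on a finite graph). -/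
instance instDecConn (ω : Config (Fin 6)) (u v : Fin 5) : Decidable (Conn ends ω u v) :=
  inferInstanceAs (Decidable ((openGraph ends ω).Reachable u v))

/-- The avoidance event `R = {0 ↮ 4}`. -/
def Rv : Set (Config (Fin 6)) := avoidAll ends 0 {4}

/-- The up-set event `U = {1 ∈ C_0}`. -/
def U : Set (Config (Fin 6)) := clusterInEvent ends 0 {S | (1 : Fin 5) ∈ S}

/-- The up-set event `e = {3 ∈ C_0}`. -/
def e : Set (Config (Fin 6)) := clusterInEvent ends 0 {S | (3 : Fin 5) ∈ S}

/-- Membership in `R` is decidable. -/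
instance instDecR : DecidablePred (· ∈ Rv) := fun ω =>
  inferInstanceAs (Decidable (∀ x ∈ ({4} : Finset (Fin 5)), ¬ Conn ends ω 0 x))

/-- Membership in `U` is decidable. -/
instance instDecU : DecidablePred (· ∈ U) := fun ω => inferInstanceAs (Decidable (Conn ends ω 0 1))

/-- Membership in `e` is decidable. -/
instance instDecE : DecidablePred (· ∈ e) := fun ω => inferInstanceAs (Decidable (Conn ends ω 0 3))

/-- `P(A) = (Σ_{ω ∈ A} wt ω) / 8⁶`. -/
lemma prob_eq_mass (A : Set (Config (Fin 6))) [DecidablePred (· ∈ A)] :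
    prob p A = ((∑ ω ∈ Finset.univ.filter (· ∈ A), wt ω : ℕ) : ℚ) / 8 ^ 6 := by
  rw [prob_eq_sum_filter, Nat.cast_sum, Finset.sum_div]
  exact Finset.sum_congr rfl fun ω _ => weight_eq ω

/-- `8⁶ · P(R) = 230976`. -/
theorem mass_R : ∑ ω ∈ Finset.univ.filter (· ∈ Rv), wt ω = 230976 := by decide

/-- `8⁶ · P(U) = 226816`. -/
theorem mass_U : ∑ ω ∈ Finset.univ.filter (· ∈ U), wt ω = 226816 := by decide

/-- `8⁶ · P(e) = 226816`. -/
theorem mass_e : ∑ ω ∈ Finset.univ.filter (· ∈ e), wt ω = 226816 := by decide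

/-- `8⁶ · P(R ∩ U) = 199424`. -/
theorem mass_RU : ∑ ω ∈ Finset.univ.filter (· ∈ Rv ∩ U), wt ω = 199424 := by decide

/-- `8⁶ · P(R ∩ e) = 199424`. -/
theorem mass_Re : ∑ ω ∈ Finset.univ.filter (· ∈ Rv ∩ e), wt ω = 199424 := by decide

/-- `8⁶ · P(Rᶜ ∩ U ∩ e) = 24064`. -/
theorem mass_RcUe : ∑ ω ∈ Finset.univ.filter (· ∈ Rvᶜ ∩ U ∩ e), wt ω = 24064 := by decide

/-- **The (CR) form is negative on `Θ₅`**: `P(R)·P(Rᶜ U e) + P(R U)·P(R e) − P(R)·P(U)·P(e) = −10481/2³⁰`. -/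
theorem crForm_eq :
    prob p Rv * prob p (Rvᶜ ∩ U ∩ e) + prob p (Rv ∩ U) * prob p (Rv ∩ e)
      - prob p Rv * prob p U * prob p e = -10481 / 2 ^ 30 := by
  rw [prob_eq_mass Rv, prob_eq_mass (Rvᶜ ∩ U ∩ e), prob_eq_mass (Rv ∩ U), prob_eq_mass (Rv ∩ e),
    prob_eq_mass U, prob_eq_mass e, mass_R, mass_RcUe, mass_RU, mass_Re, mass_U, mass_e]
  norm_num

/-- `{S ∣ v ∈ S}` is an up-set. -/
lemma isUpperSet_mem (v : Fin 5) : IsUpperSet {S : Set (Fin 5) | v ∈ S} := fun _ _ h hv => h hv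

/-- **(CR) is false**: the hypothesis `hcr` of `CRForms.xorForm_nonneg_of_cr` fails on `Θ₅`. -/
theorem not_cr :
    ¬ (let Rv := avoidAll ends 0 {4}
       let U := clusterInEvent ends 0 {S : Set (Fin 5) | (1 : Fin 5) ∈ S}
       let e := clusterInEvent ends 0 {S : Set (Fin 5) | (3 : Fin 5) ∈ S}
       0 ≤ prob p Rv * prob p (Rvᶜ ∩ U ∩ e) + prob p (Rv ∩ U) * prob p (Rv ∩ e) -
         prob p Rv * prob p U * prob p e) := by
  intro h
  simp only at h
  have := crForm_eq
  unfold Rv U e at this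
  rw [this] at h
  norm_num at h

/-- **(CR) is false in general**: the universal statement over admissible rational weights, all finite
graphs, roots, avoided sets and up-sets fails. -/
theorem not_cr_general :
    ¬ ∀ (V E : Type) [Fintype V] [DecidableEq V] [Fintype E] [DecidableEq E] (p : E → ℚ),
      IsProbVec p → ∀ (ends : E → Sym2 V) (s : V) (X : Finset V) (𝓤 𝓥 : Set (Set V)),
      IsUpperSet 𝓤 → IsUpperSet 𝓥 →
      (let Rv := avoidAll ends s X
       let U := clusterInEvent ends s 𝓤
       let e := clusterInEvent ends s 𝓥
       0 ≤ prob p Rv * prob p (Rvᶜ ∩ U ∩ e) + prob p (Rv ∩ U) * prob p (Rv ∩ e) -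
         prob p Rv * prob p U * prob p e) := by
  intro h
  exact not_cr (h (Fin 5) (Fin 6) p p_isProbVec ends 0 {4} _ _ (isUpperSet_mem 1) (isUpperSet_mem 3))

end CRCounterexample

end Summit.Ventures.PercRepro2
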